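import Literature.InformationTheory.QuantumCodes.TwistedToricWalks
import HarnessLib

/-!
# Toric codes on twisted tori — every cycle is an edge-disjoint sum of closed walks (Euler decomposition)

Topic `InformationTheory/QuantumCodes`; namespace `Literature.InformationTheory.QuantumCodes.TwistedToric`.
LADDER-QEC (cell `qec`), PARTITION row 08, item 08.TWIST (file 3 of the distance proof of `TwistedToricCodes.lean`).

On the Cayley graph of `(V; g₁, g₂)` (`V` a finite additive group; loops and parallel edges allowed, `𝔽₂`
coefficients throughout): a `1`-chain `z : V ⊕ V → 𝔽₂` whose star sum is `vtx u + vtx v` («an error chain with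
endpoints `u, v`», Dennis–Kitaev–Landahl–Preskill §3.1) is the chain of ONE walk from `u` to `v` plus the chains of
finitely many CLOSED walks, the total number of steps being exactly the weight of `z` (`decompose`): induction on
the weight, peeling one edge at an odd-degree endpoint (or anywhere, when `u = v`). Consequently every CYCLE (zero
star sum) is a sum of closed-walk chains with total length `= |z|` (`cycle_decomposition`). This is the
combinatorial input that reduces the distance lower bound to a statement about single closed walks
(`TwistedToricHomology.lean`).

0 named facts, no instances, no notation; elementary (Euler/Hierholzer-type peeling, stated for this graph only).

## References
* [DennisEtAl2002] Dennis–Kitaev–Landahl–Preskill, J. Math. Phys. 43 (2002), §3.1 (held chunk p0008 L1-5: error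
  chains, their boundary = endpoints, cycles; «any cycle … is a sum of closed loops» is the implicit homology
  bookkeeping of §3.1/§4.2).
* [KovalevPryadko2012] Kovalev–Pryadko, arXiv:1202.0928, §III.C (p0005 L72-80: the shortest topologically
  non-trivial chain).
-/

namespace Literature.InformationTheory.QuantumCodes

open Matrix Finset

namespace TwistedToric

section Decompose

variable {V : Type*} [AddCommGroup V] [DecidableEq V]

omit [DecidableEq V] in
/-- The star sum at `i` is the sum of the chain over the four step-edges at `i` (definitional).
[cite: DennisEtAl2002, §3.1 (the star operator X_s acts on the four links meeting s)] -/
theorem star_eq_sum_edges (g₁ g₂ : V) (z : V ⊕ V → ZMod 2) (i : V) :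
    star g₁ g₂ z i = z (Step.hp.edge g₁ g₂ i) + z (Step.hm.edge g₁ g₂ i) + z (Step.vp.edge g₁ g₂ i)
      + z (Step.vm.edge g₁ g₂ i) := rfl

omit [DecidableEq V] in
/-- Every edge is the forward edge of a step: `inl j = hp.edge j`, `inr j = vp.edge j`.
[cite: DennisEtAl2002, §3.1 (links of the lattice)] -/
theorem exists_step_edge (g₁ g₂ : V) (e : V ⊕ V) : ∃ (s : Step) (p : V), e = s.edge g₁ g₂ p := by
  cases e with
  | inl j => exact ⟨Step.hp, j, rfl⟩
  | inr j => exact ⟨Step.vp, j, rfl⟩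

omit [AddCommGroup V] in
/-- `vtx u i = [i = u]`. [cite: DennisEtAl2002, §3.1 (sites of the lattice)] -/
theorem vtx_apply (u i : V) : vtx u i = if i = u then 1 else 0 := by
  simp [vtx, Pi.single_apply]

omit [AddCommGroup V] in
/-- If `vtx u + vtx v = 0` pointwise then `u = v` (two distinct endpoints do not cancel).
[cite: DennisEtAl2002, §3.1 (the boundary of an open chain is its pair of endpoints)] -/
theorem eq_of_vtx_add_vtx_eq_zero {u v : V} (h : ∀ i, vtx u i + vtx v i = 0) : u = v := by
  have hu := h u
  rw [CharTwo.add_eq_zero, vtx_apply, vtx_apply, if_pos rfl] at hu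
  by_contra huv
  rw [if_neg huv] at hu
  exact one_ne_zero hu

/-- A chain plus itself vanishes (`𝔽₂` coefficients). [folklore] -/
private theorem chain_add_self {α : Type*} (x : α → ZMod 2) : x + x = 0 := by
  funext a; exact CharTwo.add_self_eq_zero (x a)

omit [AddCommGroup V] in
/-- Flipping an edge of the support lowers the weight by one: `|z + e| + 1 = |z|` when `z(e) ≠ 0`.
[cite: DennisEtAl2002, §3.1 (chains with ℤ₂ coefficients: adding a link of E to E removes it)] -/
theorem hammingNorm_add_single_of_ne_zero [Fintype V] {z : V ⊕ V → ZMod 2} {e : V ⊕ V} (he : z e ≠ 0) :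
    hammingNorm (z + Pi.single e 1) + 1 = hammingNorm z := by
  have hz1 : z e = 1 := by
    have := CharTwo.intCast_cases (R := ZMod 2)
    revert he; generalize z e = a; revert a; decide
  have hupd : z + Pi.single e 1 = Function.update z e 0 := by
    funext a
    by_cases ha : a = e
    · subst ha; simp [hz1, CharTwo.add_self_eq_zero]
    · simp [ha]
  rw [hupd]
  unfold hammingNorm
  have hset : (Finset.univ.filter fun a => Function.update z e 0 a ≠ 0)
      = (Finset.univ.filter fun a => z a ≠ 0).erase e := by
    ext a
    by_cases ha : a = e
    · subst ha; simp
    · simp [ha]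
  rw [hset, Finset.card_erase_of_mem (by simpa using he)]
  have hpos : 0 < (Finset.univ.filter fun a => z a ≠ 0).card :=
    Finset.card_pos.2 ⟨e, by simpa using he⟩
  omega

/-- The zero chain with vanishing boundary `vtx u + vtx v`: then `u = v` and the empty walk does it.
[cite: DennisEtAl2002, §3.1 (the empty chain has no boundary)] -/
theorem decompose_zero [Fintype V] (g₁ g₂ : V) {u v : V} (h : ∀ i, star g₁ g₂ (0 : V ⊕ V → ZMod 2) i = vtx u i + vtx v i) :
    ∃ (w : List Step) (cs : List (V × List Step)),
      endPos g₁ g₂ u w = v ∧ (∀ c ∈ cs, endPos g₁ g₂ c.1 c.2 = c.1) ∧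
      (0 : V ⊕ V → ZMod 2) = wchain g₁ g₂ u w + (cs.map fun c => wchain g₁ g₂ c.1 c.2).sum ∧
      w.length + (cs.map fun c => c.2.length).sum = hammingNorm (0 : V ⊕ V → ZMod 2) := by
  have huv : u = v := eq_of_vtx_add_vtx_eq_zero fun i => by rw [← h i, star_zero]
  subst huv
  exact ⟨[], [], rfl, fun c hc => by simp at hc, by simp, by simp⟩

/-- **Euler decomposition with two marked endpoints.** If the star sum of `z` is `vtx u + vtx v`, then `z` is the
chain of a walk from `u` to `v` plus the chains of closed walks, with total number of steps equal to the weight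
of `z` (so the walks are edge-disjoint and use exactly the support of `z`).
[cite: DennisEtAl2002, §3.1 (chunk p0008 L1-3: an error chain is a collection of paths whose boundary is the set of endpoints, plus closed loops)] -/
theorem decompose [Fintype V] (g₁ g₂ : V) :
    ∀ (n : ℕ) (z : V ⊕ V → ZMod 2) (u v : V), hammingNorm z ≤ n →
      (∀ i, star g₁ g₂ z i = vtx u i + vtx v i) →
      ∃ (w : List Step) (cs : List (V × List Step)),
        endPos g₁ g₂ u w = v ∧ (∀ c ∈ cs, endPos g₁ g₂ c.1 c.2 = c.1) ∧
        z = wchain g₁ g₂ u w + (cs.map fun c => wchain g₁ g₂ c.1 c.2).sum ∧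
        w.length + (cs.map fun c => c.2.length).sum = hammingNorm z := by
  intro n
  induction n with
  | zero =>
    intro z u v hn h
    have hz : z = 0 := hammingNorm_eq_zero.1 (Nat.le_zero.1 hn)
    subst hz
    exact decompose_zero g₁ g₂ h
  | succ n ih =>
    intro z u v hn h
    by_cases hz : z = 0
    · subst hz; exact decompose_zero g₁ g₂ h
    by_cases huv : u = v
    · -- closed boundary: peel an arbitrary edge `e = s.edge p` and recurse from `s.move p` back to `p`
      subst huv
      obtain ⟨e, he⟩ : ∃ e, z e ≠ 0 := by
        by_contra hne
        exact hz (funext fun e => not_not.1 (not_exists.1 hne e))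
      obtain ⟨s, p, rfl⟩ := exists_step_edge g₁ g₂ e
      set z' := z + Pi.single (s.edge g₁ g₂ p) 1 with hz'
      have hwt : hammingNorm z' + 1 = hammingNorm z := hammingNorm_add_single_of_ne_zero he
      have hn' : hammingNorm z' ≤ n := by omega
      have h' : ∀ i, star g₁ g₂ z' i = vtx (s.move g₁ g₂ p) i + vtx p i := by
        intro i
        rw [hz', star_add, h i, CharTwo.add_self_eq_zero, zero_add, star_edge, add_comm]
      obtain ⟨w', cs', hend, hcl, hsum, hlen⟩ := ih z' (s.move g₁ g₂ p) p hn' h'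
      refine ⟨[], (p, s :: w') :: cs', rfl, ?_, ?_, ?_⟩
      · intro c hc
        rw [List.mem_cons] at hc
        rcases hc with rfl | hc
        · exact hend
        · exact hcl c hc
      · have hzz : z = z' + Pi.single (s.edge g₁ g₂ p) 1 := by
          rw [hz', add_assoc, chain_add_self, add_zero]
        rw [hzz, hsum]
        simp only [wchain_nil, List.map_cons, List.sum_cons, wchain_cons, zero_add]
        abel
      · simp only [List.length_nil, List.map_cons, List.sum_cons, List.length_cons, zero_add]
        rw [← hwt, ← hlen]
        ring
    · -- open boundary: `u` has odd degree, so some step-edge at `u` lies in the support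
      obtain ⟨s, hs⟩ : ∃ s : Step, z (s.edge g₁ g₂ u) ≠ 0 := by
        by_contra hne
        have hne' : ∀ s : Step, z (s.edge g₁ g₂ u) = 0 := fun s => not_not.1 (not_exists.1 hne s)
        have hu := h u
        rw [star_eq_sum_edges, hne', hne', hne', hne', vtx_apply, vtx_apply, if_pos rfl, if_neg huv] at hu
        simp at hu
      set z' := z + Pi.single (s.edge g₁ g₂ u) 1 with hz'
      have hwt : hammingNorm z' + 1 = hammingNorm z := hammingNorm_add_single_of_ne_zero hs
      have hn' : hammingNorm z' ≤ n := by omega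
      have h' : ∀ i, star g₁ g₂ z' i = vtx (s.move g₁ g₂ u) i + vtx v i := by
        intro i
        rw [hz', star_add, h i, star_edge]
        rw [add_comm (vtx u i) (vtx v i), add_assoc, ← add_assoc (vtx u i), CharTwo.add_self_eq_zero, zero_add,
          add_comm]
      obtain ⟨w', cs', hend, hcl, hsum, hlen⟩ := ih z' (s.move g₁ g₂ u) v hn' h'
      refine ⟨s :: w', cs', hend, hcl, ?_, ?_⟩
      · have hzz : z = z' + Pi.single (s.edge g₁ g₂ u) 1 := by
          rw [hz', add_assoc, chain_add_self, add_zero]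
        rw [hzz, hsum, wchain_cons]
        abel
      · rw [List.length_cons, ← hwt, ← hlen]
        ring

/-- **Every cycle is a sum of closed walks using exactly its edges**: if `z` has zero star sum everywhere, there
are closed walks `(vₖ, wₖ)` with `z = Σₖ wchain vₖ wₖ` and `Σₖ |wₖ| = |z|`.
[cite: DennisEtAl2002, §3.1 (chunk p0008 L1-5: a cycle — a chain with no boundary — as a sum of closed loops, homologically trivial or not)] -/
theorem cycle_decomposition [Fintype V] (g₁ g₂ : V) (z : V ⊕ V → ZMod 2) (hz : ∀ i, star g₁ g₂ z i = 0) :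
    ∃ cs : List (V × List Step), (∀ c ∈ cs, endPos g₁ g₂ c.1 c.2 = c.1) ∧
      z = (cs.map fun c => wchain g₁ g₂ c.1 c.2).sum ∧ (cs.map fun c => c.2.length).sum = hammingNorm z := by
  have h : ∀ i, star g₁ g₂ z i = vtx (0 : V) i + vtx (0 : V) i := fun i => by
    rw [hz, CharTwo.add_self_eq_zero]
  obtain ⟨w, cs, hend, hcl, hsum, hlen⟩ := decompose g₁ g₂ (hammingNorm z) z 0 0 le_rfl h
  refine ⟨((0 : V), w) :: cs, ?_, ?_, ?_⟩
  · intro c hc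
    rw [List.mem_cons] at hc
    rcases hc with rfl | hc
    · exact hend
    · exact hcl c hc
  · simpa using hsum
  · simpa using hlen

end Decompose

end TwistedToric

end Literature.InformationTheory.QuantumCodes
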